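import Mathlib
import Summits.Ventures.PercRepro2.Defs
import Summits.Ventures.PercRepro2.Graph
import Summits.Ventures.PercRepro2.OneColourSwitch
import Summits.Ventures.PercRepro2.M9PendantMirror
import Summits.Ventures.PercRepro2.SideSwitch
import Summits.Ventures.PercRepro2.SideSwitchCompsM9
import Summits.Ventures.PercRepro2.CutVertexPaths
import Summits.Ventures.PercRepro2.CutVertexM9
import Summits.Ventures.PercRepro2.M9LoopTransfer
import Summits.Ventures.PercRepro2.M9PendantSeries

/-!
# The reducible class for `m9`: the class generated by the landed class theorems under the
pendant and series reductions (blind cell PercRepro2, p3 g19, 2026-08-27)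

`Reducible p q r s ends` is the smallest class of marked multigraphs (on the edge type `E`)
containing the bases on which `Σ_{Sep} σ_pq · σ_rs ≤ 0` is a kernel theorem — the `DZero` class
of `SideSwitchCompsM9` (no non-mark doubly reached) and the cut-vertex class of `CutVertexM9` —
closed under the swap of the two pairs and under the two exact reductions of `M9PendantSeries`:
looping the single non-loop edge of a non-mark, and replacing the two non-loop edges `{d, x}`,
`{d, y}` of a non-mark by the edge `{x, y}` (with both resulting graphs in the class).  The
theorem `m9SignSum_nonpos_of_reducible` proves `m9` on the whole class by induction on the
derivation; every future class theorem can be added as a base.  Own work, one seat.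
-/

namespace Summit.Ventures.PercRepro2

namespace M9Reduce

open OneColourSwitch SideSwitch CutVertexM9 Classical Finset

variable {V : Type*} {E : Type*}

section Reducible

variable [Fintype V] [DecidableEq V] [Fintype E] [DecidableEq E]

/-- The reducible class: bases (`DZero`, cut vertex), the pair swap, and the pendant / series
reductions. -/
inductive Reducible : V → V → V → V → (E → Sym2 V) → Prop
  /-- base: no non-mark is doubly reached in any `Sep` colouring (`SideSwitchCompsM9`) -/
  | dzero {p q r s : V} {ends : E → Sym2 V} (h : ∀ ω, sep2 ends p q r s ω → DZero ends r s ω) :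
      Reducible p q r s ends
  /-- base: a cut vertex between the pairs (`CutVertexM9`) -/
  | cut {p q r s : V} {ends : E → Sym2 V} (side : E → Bool) (L : Set V) (v : V) (Rt : Set V)
      (h : CutVertex ends side L v Rt) (hp : p ∈ L ∨ p = v) (hq : q ∈ L ∨ q = v)
      (hr : r ∈ Rt ∨ r = v) (hs : s ∈ Rt ∨ s = v) : Reducible p q r s ends
  /-- the pair swap -/
  | swap {p q r s : V} {ends : E → Sym2 V} (h : Reducible r s p q ends) : Reducible p q r s ends
  /-- the pendant reduction: loop the single non-loop edge `e₀ = {d, v}` of a non-mark `d` -/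
  | pendant {p q r s : V} {ends : E → Sym2 V} {e₀ : E} {d v : V}
      (hd : ∀ e, d ∈ ends e → ¬ (ends e).IsDiag → e = e₀) (he₀ : ends e₀ = s(d, v))
      (hp : p ≠ d) (hq : q ≠ d) (hr : r ≠ d) (hs : s ≠ d)
      (h : Reducible p q r s (Function.update ends e₀ s(d, d))) : Reducible p q r s ends
  /-- the series reduction: the two non-loop edges `{d, x}`, `{d, y}` of a non-mark `d` become the
  edge `{x, y}` (and, on the mixed colourings, two loops) -/
  | series {p q r s : V} {ends : E → Sym2 V} {e₁ e₂ : E} {d x y : V} (hne : e₁ ≠ e₂)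
      (hd : ∀ e, d ∈ ends e → ¬ (ends e).IsDiag → e = e₁ ∨ e = e₂)
      (h₁ : ends e₁ = s(d, x)) (h₂ : ends e₂ = s(d, y)) (hx : x ≠ d) (hy : y ≠ d)
      (hp : p ≠ d) (hq : q ≠ d) (hr : r ≠ d) (hs : s ≠ d)
      (hG₁ : Reducible p q r s (Function.update (Function.update ends e₁ s(x, y)) e₂ s(d, d)))
      (hG₀ : Reducible p q r s (Function.update (Function.update ends e₁ s(d, d)) e₂ s(d, d))) :
      Reducible p q r s ends

/-- **`m9` in sign form on the reducible class**: `Σ_{Sep} σ_pq · σ_rs ≤ 0` on every marked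
multigraph obtained from a `DZero` graph or a cut-vertex graph by pair swaps and pendant / series
reductions. -/
theorem m9SignSum_nonpos_of_reducible {p q r s : V} {ends : E → Sym2 V}
    (h : Reducible p q r s ends) : m9SignSum ends p q r s ≤ 0 := by
  induction h with
  | dzero h => exact m9SignSum_nonpos_of_DZero h
  | cut side L v Rt h hp hq hr hs => exact CutVertexM9.m9SignSum_nonpos_of_cutVertex h hp hq hr hs
  | swap _ ih => rw [m9SignSum_comm]; exact ih
  | pendant hd he₀ hp hq hr hs _ ih => rw [m9SignSum_pendant hd he₀ hp hq hr hs]; exact ih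
  | series hne hd h₁ h₂ hx hy hp hq hr hs _ _ ih₁ ih₀ =>
    have hid := m9SignSum_series hne hd h₁ h₂ hx hy hp hq hr hs
    linarith

end Reducible

end M9Reduce

end Summit.Ventures.PercRepro2
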